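import Summits.Ventures.CertifiedQuantumChemistry.Rows.SingletVersusSector
import HarnessLib

/-!
# Ventures/CertifiedQuantumChemistry — Rows/SingletFromSectorGap.lean: a certified singlet ground
# state from a SECTOR upper row and one `S_z = 1` sector lower row

HONEST FRAMING (verbatim): certified bounds for a stated model Hamiltonian in a stated basis; not a
claim about the real molecule beyond that model.

Seat rdm-B (gen 7), zero compute, nothing landed is touched. `Rows/SingletVersusSector.lean` proves
`E(n, n) = min (E₀(2n, S = 0), E(n + 1, n − 1))` and reads a certified singlet ground state off a
SINGLET upper row `SingletUpperRow F n hi` and an `(n + 1, n − 1)` sector lower row `lo` with `hi < lo`.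
This file records the remark that the gap test needs NO singlet-adapted upper certificate: an ordinary
`(n, n)` SECTOR upper row `UpperRow F n n hi` (an FCI / selected-CI / MPS integer-vector certificate —
every two-sided sector row of CERTIFIED.md carries one) does the same job, because
`E(n, n) ≤ hi < lo ≤ E(n + 1, n − 1)` already forces the minimum to be attained by the singlet energy.
So ONE extra `S_z = 1` sector lower leg on a file that has a two-sided `(n, n)` sector row certifies,
when the gap test `hi < lo` passes in exact arithmetic:

* `UpperRow.energy_eq_singletEnergy_of_sectorGap` — `E(n, n) = E₀(2n, S = 0) < E(n + 1, n − 1)`;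
* `UpperRow.singletUpperRow_of_sectorGap` — the sector `U` is a singlet `U`;
* `SingletLowerRow.lowerRow_of_sectorGap` / `SingletLowerRow.bracket_of_sectorGap` — a singlet-restricted
  `L` (CERTIFIED key `e0S0[…]`, relaxation `DQG + ⟨Ŝ²⟩ = 0`, usually tighter than the plain sector `L`)
  is a SECTOR `L`, so it brackets the sector energy together with the sector `U`;
* `spinPlus_mulVec_eq_zero_of_sectorGap` — every ground vector of the `(n, n)` sector is annihilated by
  `Ŝ_+`: the model's `2n`-electron ground states in `S_z = 0` are singlets.

Everything is PROVED (0 sorry); no definition, no claim node; nothing in this file asserts any bound.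
-/

noncomputable section

namespace Summit.Ventures.CertifiedQuantumChemistry

open Matrix Finset
open Literature.MathematicalPhysics.QuantumLattice Literature.MathematicalPhysics.QuantumChemistry
open scoped ComplexOrder

variable {k : ℕ}

/-- **Gap test from sector rows.** An `(n, n)` sector UPPER row `hi` and an `(n + 1, n − 1)` sector
LOWER row `lo` with `hi < lo` give `E(n, n) < E(n + 1, n − 1)` (no symmetry hypothesis). -/
theorem UpperRow.energy_lt_energy_succ_pred_of_gap {F : Model k} {n : ℕ} {hi lo : ℚ}
    (hU : UpperRow F n n hi) (hL : LowerRow F (n + 1) (n - 1) lo) (hgap : hi < lo) :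
    F.energy n n < F.energy (n + 1) (n - 1) :=
  lt_of_le_of_lt hU.le (lt_of_lt_of_le (by exact_mod_cast hgap) hL.le)

/-- **Certified singlet ground state from SECTOR rows.** For a symmetric model, an `(n, n)` sector
UPPER row `hi` and an `(n + 1, n − 1)` sector LOWER row `lo` with `hi < lo` prove
`E(n, n) = E₀(H_F; 2n, S = 0)` and `E₀(2n, S = 0) < E(n + 1, n − 1)`. -/
theorem UpperRow.energy_eq_singletEnergy_of_sectorGap {F : Model k} (hF : F.IsSymmetric) {n : ℕ}
    {hi lo : ℚ} (hU : UpperRow F n n hi) (hL : LowerRow F (n + 1) (n - 1) lo) (hgap : hi < lo) :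
    F.energy n n = F.singletEnergy n ∧ F.singletEnergy n < F.energy (n + 1) (n - 1) := by
  have hlt : F.energy n n < F.energy (n + 1) (n - 1) :=
    UpperRow.energy_lt_energy_succ_pred_of_gap hU hL hgap
  have hmin := Model.min_singletEnergy_energy_le hF hU.range.1
  have hle : F.singletEnergy n ≤ F.energy n n := by
    rcases le_total (F.singletEnergy n) (F.energy (n + 1) (n - 1)) with h | h
    · rwa [min_eq_left h] at hmin
    · rw [min_eq_right h] at hmin
      exact absurd (hmin.trans_lt hlt) (lt_irrefl _)
  have heq : F.energy n n = F.singletEnergy n :=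
    le_antisymm (Model.energy_le_singletEnergy hF hU.range.1) hle
  exact ⟨heq, heq ▸ hlt⟩

/-- Under the sector gap test, the `(n, n)` sector UPPER row is a SINGLET upper row. -/
theorem UpperRow.singletUpperRow_of_sectorGap {F : Model k} (hF : F.IsSymmetric) {n : ℕ}
    {hi lo : ℚ} (hU : UpperRow F n n hi) (hL : LowerRow F (n + 1) (n - 1) lo) (hgap : hi < lo) :
    SingletUpperRow F n hi :=
  ⟨hU.range.1, (UpperRow.energy_eq_singletEnergy_of_sectorGap hF hU hL hgap).1 ▸ hU.le⟩

/-- Under the sector gap test, a SINGLET lower row is an `(n, n)` SECTOR lower row. -/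
theorem SingletLowerRow.lowerRow_of_sectorGap {F : Model k} (hF : F.IsSymmetric) {n : ℕ}
    {lo₁ hi lo : ℚ} (hS : SingletLowerRow F n lo₁) (hU : UpperRow F n n hi)
    (hL : LowerRow F (n + 1) (n - 1) lo) (hgap : hi < lo) : LowerRow F n n lo₁ :=
  ⟨hS.range, hS.range,
    hS.le.trans_eq (UpperRow.energy_eq_singletEnergy_of_sectorGap hF hU hL hgap).1.symm⟩

/-- **The row upgrade.** Under the sector gap test, a singlet-restricted lower row `lo₁` and the sector
upper row `hi` bracket the `(n, n)` SECTOR energy: `Bracket F n n lo₁ hi`. -/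
theorem SingletLowerRow.bracket_of_sectorGap {F : Model k} (hF : F.IsSymmetric) {n : ℕ}
    {lo₁ hi lo : ℚ} (hS : SingletLowerRow F n lo₁) (hU : UpperRow F n n hi)
    (hL : LowerRow F (n + 1) (n - 1) lo) (hgap : hi < lo) : Bracket F n n lo₁ hi :=
  ⟨hS.lowerRow_of_sectorGap hF hU hL hgap, hU⟩

/-- Under the sector gap test, a singlet-restricted lower row `lo₁` and the sector upper row `hi`
bracket the `2n`-electron ground energy of the model. -/
theorem SingletLowerRow.groundEnergy_mem_of_sectorGap {F : Model k} (hF : F.IsSymmetric) {n : ℕ}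
    {lo₁ hi lo : ℚ} (hS : SingletLowerRow F n lo₁) (hU : UpperRow F n n hi)
    (hL : LowerRow F (n + 1) (n - 1) lo) (hgap : hi < lo) :
    ((lo₁ : ℚ) : ℝ) ≤ groundEnergy F.hamiltonian (2 * n) ∧
      groundEnergy F.hamiltonian (2 * n) ≤ ((hi : ℚ) : ℝ) :=
  (hS.bracket_of_sectorGap hF hU hL hgap).groundEnergy_mem hF

/-- **The MODEL's `2n`-electron ground states in `S_z = 0` are singlets**, certified from SECTOR rows:
under the sector gap test every eigenvector of `H_F` in the `(n, n)` sector at the sector energy is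
annihilated by `Ŝ_+`. -/
theorem spinPlus_mulVec_eq_zero_of_sectorGap {F : Model k} (hF : F.IsSymmetric) {n : ℕ} {hi lo : ℚ}
    (hU : UpperRow F n n hi) (hL : LowerRow F (n + 1) (n - 1) lo) (hgap : hi < lo)
    {χ : Fock (Orb (Fin k))} (hχ : IsInSector n n χ)
    (hHχ : F.hamiltonian *ᵥ χ = ((F.energy n n : ℝ) : ℂ) • χ) : spinPlus *ᵥ χ = 0 :=
  spinPlus_mulVec_eq_zero_of_sectorGroundEnergy_lt (F.hamiltonian_isHermitian hF)
    (molecularHamiltonian_commute_spinPlus _ _ _)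
    (UpperRow.energy_lt_energy_succ_pred_of_gap hU hL hgap) hχ hHχ

end Summit.Ventures.CertifiedQuantumChemistry

end
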